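import Summits.Parity.GeneralizedHardyLittlewood.Theorems.PrimeLevelFamEdgeMomentsBeyondDiagonalLayersSharpFlat
import HarnessLib

/-!
# Route `PrimeLevelFamEdge`, crux K_A `MomentsBeyondDiagonal` (stmt-Parity-20007), line «petersson_layers» v4:
# the CLASS KERNEL — per sharp class, the `k = 0` form is a dilated bilinear Kloosterman form at modulus `c/g`
# with Pascadi's coprimality (assembly step E3, algebraic part)

After `…LayersSharpFlat.sum_four_eq_sum_sharp_classes`, a sharp class `(s₁,t₁,s₂,t₂)` of the `k = 0` form of
`…LayersFormReductionZero` is a four-fold sum over FLATS `f₁,h₁,f₂,h₂` (all prime to `c`) of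
`a(s₁f₁,s₂f₂) b(t₁h₁,t₂h₂) S(s₁f₁·t₁h₁, s₂f₂·t₂h₂; c)`.  With the CLASS datum `σ₁ = s₁t₁`, `σ₂ = s₂t₂`,
`g = ((σ₁,σ₂),c)` (a function of the class only: `gcd_gcd_mul_flat_eq`), the kernel is
`S(s₁f₁·t₁h₁, s₂f₂·t₂h₂; c) = (φ(c)/φ(c/g)) · S((σ₁/g)·f₁f₂, (σ₂/g)·h₁h₂; c/g)` (`kloostermanSum_class_normal_form`,
the class-level form of `…LayersTermNormalForm`), with `(((σ₁/g)f₁f₂, (σ₂/g)h₁h₂), c/g) = 1` (`coprime_class_normal_form`)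
and `φ(c/g) > 0`; hence (**`classForm_eq`**) the class form is `(φ(c)/φ(c/g))` times a four-fold sum over plain
boxes `f₁ ≤ Z₁, h₁ ≤ W₁, f₂ ≤ Z₂, h₂ ≤ W₂` of `A(f₁,f₂)·B(h₁,h₂)·S((σ₁/g)(f₁f₂), (σ₂/g)(h₁h₂); c/g)` whose coefficients
vanish off the flats — exactly the kernel-on-support shape of `…LayersBlockPascadiBound.norm_sum_four_le_of_pascadi` /
`…LayersBlockFourierBound.norm_sum_four_le_fourier` at the modulus `c/g` (remaining: per-class bounds, the class count and
the exponent bookkeeping, steps E4–E6 of the census; NOT done here).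
Proof only (def-free helper); no form is bounded here; K_A NOT proved; nothing about Landau–Siegel zeros.
-/

noncomputable section

open Finset
open Literature.NumberTheory.LFunctions

namespace Summit.Parity.GeneralizedHardyLittlewood.Theorems.MomentsBeyondDiagonal.Layers

/-! ## §1. The class datum `g = ((σ₁, σ₂), c)` -/

/-- **The gcd datum is a class invariant**: for flats `u₁, u₂` prime to `c`,
`((σ₁u₁, σ₂u₂), c) = ((σ₁, σ₂), c)`. [folklore] -/
theorem gcd_gcd_mul_flat_eq {σ₁ σ₂ u₁ u₂ c : ℕ} (hu₁ : Nat.Coprime u₁ c) (hu₂ : Nat.Coprime u₂ c) :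
    Nat.gcd (Nat.gcd (σ₁ * u₁) (σ₂ * u₂)) c = Nat.gcd (Nat.gcd σ₁ σ₂) c := by
  apply Nat.dvd_antisymm
  · set G := Nat.gcd (Nat.gcd (σ₁ * u₁) (σ₂ * u₂)) c with hG
    have hGc : G ∣ c := Nat.gcd_dvd_right _ _
    have hG1 : G ∣ σ₁ * u₁ := (Nat.gcd_dvd_left _ _).trans (Nat.gcd_dvd_left _ _)
    have hG2 : G ∣ σ₂ * u₂ := (Nat.gcd_dvd_left _ _).trans (Nat.gcd_dvd_right _ _)
    have hσ₁ : G ∣ σ₁ := (Nat.Coprime.coprime_dvd_left hGc hu₁.symm).dvd_of_dvd_mul_right hG1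
    have hσ₂ : G ∣ σ₂ := (Nat.Coprime.coprime_dvd_left hGc hu₂.symm).dvd_of_dvd_mul_right hG2
    exact Nat.dvd_gcd (Nat.dvd_gcd hσ₁ hσ₂) hGc
  · refine Nat.dvd_gcd (Nat.dvd_gcd ?_ ?_) (Nat.gcd_dvd_right _ _)
    · exact ((Nat.gcd_dvd_left _ _).trans (Nat.gcd_dvd_left σ₁ σ₂)).trans (Dvd.intro u₁ rfl)
    · exact ((Nat.gcd_dvd_left _ _).trans (Nat.gcd_dvd_right σ₁ σ₂)).trans (Dvd.intro u₂ rfl)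

/-- `g = ((σ₁,σ₂),c)` divides `σ₁`, `σ₂`, `c`, and `c = g·(c/g)`. [folklore] -/
theorem classGcd_dvd (σ₁ σ₂ c : ℕ) :
    Nat.gcd (Nat.gcd σ₁ σ₂) c ∣ σ₁ ∧ Nat.gcd (Nat.gcd σ₁ σ₂) c ∣ σ₂ ∧ Nat.gcd (Nat.gcd σ₁ σ₂) c ∣ c ∧
      c = Nat.gcd (Nat.gcd σ₁ σ₂) c * (c / Nat.gcd (Nat.gcd σ₁ σ₂) c) :=
  ⟨(Nat.gcd_dvd_left _ _).trans (Nat.gcd_dvd_left σ₁ σ₂), (Nat.gcd_dvd_left _ _).trans (Nat.gcd_dvd_right σ₁ σ₂),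
    Nat.gcd_dvd_right _ _, (Nat.mul_div_cancel' (Nat.gcd_dvd_right _ _)).symm⟩

/-- If `q ∤ σ₁` then `g = ((σ₁,σ₂), qr)` divides `r` and `qr/g = q·(r/g)` (the class modulus keeps the prime cofactor).
[folklore] -/
theorem classGcd_dvd_right {q r σ₁ σ₂ : ℕ} (hq : q.Prime) (hσ₁ : ¬ q ∣ σ₁) :
    Nat.gcd (Nat.gcd σ₁ σ₂) (q * r) ∣ r ∧ q * r / Nat.gcd (Nat.gcd σ₁ σ₂) (q * r) = q * (r / Nat.gcd (Nat.gcd σ₁ σ₂) (q * r)) := by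
  set g := Nat.gcd (Nat.gcd σ₁ σ₂) (q * r) with hg
  have hgσ₁ : g ∣ σ₁ := (Nat.gcd_dvd_left _ _).trans (Nat.gcd_dvd_left σ₁ σ₂)
  have hgq : Nat.Coprime g q := by
    rw [Nat.coprime_comm, hq.coprime_iff_not_dvd]
    exact fun h ↦ hσ₁ (h.trans hgσ₁)
  have hgr : g ∣ r := hgq.dvd_of_dvd_mul_left (Nat.gcd_dvd_right _ _)
  exact ⟨hgr, Nat.mul_div_assoc q hgr⟩

/-- `0 < φ(c/g)` for `c ≥ 1`, `g ∣ c` (the class factor `φ(c)/φ(c/g)` is well defined; it is `≤ g` by `φ(g·c') ≤ g·φ(c')`,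
e.g. `Literature.NumberTheory.Sieve.BFI.totient_mul_le`, not needed here). [folklore] -/
theorem totient_div_pos {c g : ℕ} (hc : c ≠ 0) (hg : g ∣ c) : 0 < (c / g).totient := by
  have hg0 : g ≠ 0 := by rintro rfl; exact hc (zero_dvd_iff.mp hg)
  exact Nat.totient_pos.mpr (Nat.div_pos (Nat.le_of_dvd (Nat.pos_of_ne_zero hc) hg) (Nat.pos_of_ne_zero hg0))

/-! ## §2. The class kernel -/

/-- **The class-level normal form of the kernel.** With `σ₁ = s₁t₁`, `σ₂ = s₂t₂`, `g = ((σ₁,σ₂),c)` and flats `h₁, f₂`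
prime to `c`: `φ(c/g)·S(s₁f₁·t₁h₁, s₂f₂·t₂h₂; c) = φ(c)·S((σ₁/g)·(f₁f₂), (σ₂/g)·(h₁h₂); c/g)` (gcd extraction
`…LayersKloostermanScale`, then `h₁`, `f₂` swapped across as units mod `c/g`). [folklore] -/
theorem kloostermanSum_class_normal_form {c : ℕ} [NeZero c] (s₁ t₁ s₂ t₂ : ℕ) {f₁ h₁ f₂ h₂ : ℕ}
    (hh₁ : Nat.Coprime h₁ c) (hf₂ : Nat.Coprime f₂ c)
    [NeZero (c / Nat.gcd (Nat.gcd (s₁ * t₁) (s₂ * t₂)) c)] :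
    ((c / Nat.gcd (Nat.gcd (s₁ * t₁) (s₂ * t₂)) c).totient : ℂ) *
        kloostermanSum c ((s₁ * f₁ * (t₁ * h₁) : ℕ) : ZMod c) ((s₂ * f₂ * (t₂ * h₂) : ℕ) : ZMod c) =
      (c.totient : ℂ) *
        kloostermanSum (c / Nat.gcd (Nat.gcd (s₁ * t₁) (s₂ * t₂)) c)
          ((s₁ * t₁ / Nat.gcd (Nat.gcd (s₁ * t₁) (s₂ * t₂)) c * (f₁ * f₂) : ℕ) :
            ZMod (c / Nat.gcd (Nat.gcd (s₁ * t₁) (s₂ * t₂)) c))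
          ((s₂ * t₂ / Nat.gcd (Nat.gcd (s₁ * t₁) (s₂ * t₂)) c * (h₁ * h₂) : ℕ) :
            ZMod (c / Nat.gcd (Nat.gcd (s₁ * t₁) (s₂ * t₂)) c)) := by
  set g := Nat.gcd (Nat.gcd (s₁ * t₁) (s₂ * t₂)) c with hg
  set c' := c / g with hc'
  obtain ⟨hgσ₁, hgσ₂, hgc, hcg⟩ := classGcd_dvd (s₁ * t₁) (s₂ * t₂) c
  rw [← hg] at hgσ₁ hgσ₂ hgc hcg
  -- Step 1: gcd extraction
  have ha : s₁ * f₁ * (t₁ * h₁) = g * (s₁ * t₁ / g * f₁ * h₁) := by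
    calc s₁ * f₁ * (t₁ * h₁) = s₁ * t₁ * f₁ * h₁ := by ring
      _ = g * (s₁ * t₁ / g) * f₁ * h₁ := by rw [Nat.mul_div_cancel' hgσ₁]
      _ = g * (s₁ * t₁ / g * f₁ * h₁) := by ring
  have hb : s₂ * f₂ * (t₂ * h₂) = g * (f₂ * (s₂ * t₂ / g * h₂)) := by
    calc s₂ * f₂ * (t₂ * h₂) = s₂ * t₂ * f₂ * h₂ := by ring
      _ = g * (s₂ * t₂ / g) * f₂ * h₂ := by rw [Nat.mul_div_cancel' hgσ₂]
      _ = g * (f₂ * (s₂ * t₂ / g * h₂)) := by ring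
  rw [ha, hb, totient_mul_kloostermanSum_of_eq_mul (c := c') (c' := c) (g := g) hcg]
  congr 1
  -- Step 2: the flats `h₁`, `f₂` are units mod `c'`; swap them across
  have hc'c : c' ∣ c := Nat.div_dvd_of_dvd hgc
  have hu_h₁ : IsUnit ((h₁ : ℕ) : ZMod c') := (ZMod.isUnit_iff_coprime h₁ c').mpr (hh₁.coprime_dvd_right hc'c)
  have hu_f₂ : IsUnit ((f₂ : ℕ) : ZMod c') := (ZMod.isUnit_iff_coprime f₂ c').mpr (hf₂.coprime_dvd_right hc'c)
  push_cast
  rw [kloostermanSum_mul_mul_swap_of_isUnit _ _ hu_h₁ hu_f₂]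
  congr 1 <;> ring

/-- **Pascadi's summation condition, class level**: with all flats prime to `c`,
`((((σ₁/g)·f₁f₂), ((σ₂/g)·h₁h₂)), c/g) = 1`. [folklore] -/
theorem coprime_class_normal_form {c : ℕ} (hc : c ≠ 0) (s₁ t₁ s₂ t₂ : ℕ) {f₁ h₁ f₂ h₂ : ℕ}
    (hf₁ : Nat.Coprime f₁ c) (hh₁ : Nat.Coprime h₁ c) (hf₂ : Nat.Coprime f₂ c) (hh₂ : Nat.Coprime h₂ c) :
    Nat.Coprime
      (Nat.gcd (s₁ * t₁ / Nat.gcd (Nat.gcd (s₁ * t₁) (s₂ * t₂)) c * (f₁ * f₂))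
        (s₂ * t₂ / Nat.gcd (Nat.gcd (s₁ * t₁) (s₂ * t₂)) c * (h₁ * h₂)))
      (c / Nat.gcd (Nat.gcd (s₁ * t₁) (s₂ * t₂)) c) := by
  have hc'c : c / Nat.gcd (Nat.gcd (s₁ * t₁) (s₂ * t₂)) c ∣ c := Nat.div_dvd_of_dvd (Nat.gcd_dvd_right _ _)
  exact coprime_gcd_mul_mul_of_coprime ((Nat.Coprime.mul_left hf₁ hf₂).coprime_dvd_right hc'c)
    ((Nat.Coprime.mul_left hh₁ hh₂).coprime_dvd_right hc'c) (coprime_gcd_div_gcd hc)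

/-! ## §3. The class form as a dilated bilinear Kloosterman form on plain boxes -/

/-- A filtered sum as a sum with an indicator factor. [folklore] -/
theorem sum_filter_eq_sum_boole_mul (S : Finset ℕ) (p : ℕ → Prop) [DecidablePred p] (F : ℕ → ℂ) :
    ∑ x ∈ S.filter p, F x = ∑ x ∈ S, (if p x then (1 : ℂ) else 0) * F x := by
  rw [sum_filter]
  refine sum_congr rfl fun x _ ↦ ?_
  split_ifs <;> simp

/-- **The class form** (`c ≥ 1`; class `(s₁,t₁,s₂,t₂)`, `σᵢ = sᵢtᵢ`, `g = ((σ₁,σ₂),c)`): the four-fold sum over the flats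
`f₁ ≤ Z₁, h₁ ≤ W₁, f₂ ≤ Z₂, h₂ ≤ W₂` (each `(·,c) = 1`) of `a(s₁f₁,s₂f₂)·b(t₁h₁,t₂h₂)·S(s₁f₁·t₁h₁, s₂f₂·t₂h₂; c)` equals
`(φ(c)/φ(c/g))` times the four-fold sum over the PLAIN boxes of `A(f₁,f₂)·B(h₁,h₂)·S((σ₁/g)f₁f₂, (σ₂/g)h₁h₂; c/g)` with
`A = 1_{flats}·a`, `B = 1_{flats}·b`. [folklore] -/
theorem classForm_eq {c : ℕ} [NeZero c] (s₁ t₁ s₂ t₂ Z₁ W₁ Z₂ W₂ : ℕ) (a b : ℕ → ℕ → ℂ)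
    [NeZero (c / Nat.gcd (Nat.gcd (s₁ * t₁) (s₂ * t₂)) c)] :
    ∑ f₁ ∈ (Icc 1 Z₁).filter (fun f ↦ Nat.Coprime f c), ∑ h₁ ∈ (Icc 1 W₁).filter (fun f ↦ Nat.Coprime f c),
      ∑ f₂ ∈ (Icc 1 Z₂).filter (fun f ↦ Nat.Coprime f c), ∑ h₂ ∈ (Icc 1 W₂).filter (fun f ↦ Nat.Coprime f c),
        a (s₁ * f₁) (s₂ * f₂) * b (t₁ * h₁) (t₂ * h₂) *
          kloostermanSum c ((s₁ * f₁ * (t₁ * h₁) : ℕ) : ZMod c) ((s₂ * f₂ * (t₂ * h₂) : ℕ) : ZMod c) =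
      ((c.totient : ℂ) / ((c / Nat.gcd (Nat.gcd (s₁ * t₁) (s₂ * t₂)) c).totient : ℂ)) *
      ∑ f₁ ∈ Icc 1 Z₁, ∑ h₁ ∈ Icc 1 W₁, ∑ f₂ ∈ Icc 1 Z₂, ∑ h₂ ∈ Icc 1 W₂,
        (if Nat.Coprime f₁ c ∧ Nat.Coprime f₂ c then a (s₁ * f₁) (s₂ * f₂) else 0) *
          (if Nat.Coprime h₁ c ∧ Nat.Coprime h₂ c then b (t₁ * h₁) (t₂ * h₂) else 0) *
          kloostermanSum (c / Nat.gcd (Nat.gcd (s₁ * t₁) (s₂ * t₂)) c)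
            ((s₁ * t₁ / Nat.gcd (Nat.gcd (s₁ * t₁) (s₂ * t₂)) c * (f₁ * f₂) : ℕ) :
              ZMod (c / Nat.gcd (Nat.gcd (s₁ * t₁) (s₂ * t₂)) c))
            ((s₂ * t₂ / Nat.gcd (Nat.gcd (s₁ * t₁) (s₂ * t₂)) c * (h₁ * h₂) : ℕ) :
              ZMod (c / Nat.gcd (Nat.gcd (s₁ * t₁) (s₂ * t₂)) c)) := by
  have hφ0 : (((c / Nat.gcd (Nat.gcd (s₁ * t₁) (s₂ * t₂)) c).totient : ℕ) : ℂ) ≠ 0 := by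
    have h := totient_div_pos (NeZero.ne c) (Nat.gcd_dvd_right (Nat.gcd (s₁ * t₁) (s₂ * t₂)) c)
    exact_mod_cast h.ne'
  -- filtered sums as indicator sums, the class factor pulled in
  simp_rw [sum_filter_eq_sum_boole_mul, mul_sum]
  refine sum_congr rfl fun f₁ _ ↦ sum_congr rfl fun h₁ _ ↦ sum_congr rfl fun f₂ _ ↦ sum_congr rfl fun h₂ _ ↦ ?_
  by_cases hF : Nat.Coprime f₁ c ∧ Nat.Coprime f₂ c
  · by_cases hH : Nat.Coprime h₁ c ∧ Nat.Coprime h₂ c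
    · obtain ⟨hf₁, hf₂⟩ := hF
      obtain ⟨hh₁, hh₂⟩ := hH
      rw [if_pos hf₁, if_pos hh₁, if_pos hf₂, if_pos hh₂, if_pos ⟨hf₁, hf₂⟩, if_pos ⟨hh₁, hh₂⟩]
      -- the flat term: the class normal form, divided by `φ(c/g) ≠ 0`
      have key := kloostermanSum_class_normal_form (c := c) s₁ t₁ s₂ t₂ (f₁ := f₁) (h₂ := h₂) hh₁ hf₂
      simp only [one_mul]
      rw [div_mul_eq_mul_div, eq_div_iff hφ0]
      linear_combination (a (s₁ * f₁) (s₂ * f₂) * b (t₁ * h₁) (t₂ * h₂)) * key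
    · rw [if_neg hH]
      rcases not_and_or.mp hH with h | h
      · rw [if_neg h]; simp
      · rw [if_neg h]; simp
  · rw [if_neg hF]
    rcases not_and_or.mp hF with h | h
    · rw [if_neg h]; simp
    · rw [if_neg h]; simp

end Summit.Parity.GeneralizedHardyLittlewood.Theorems.MomentsBeyondDiagonal.Layers

end
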